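import Mathlib.Data.Fin.Tuple.Basic
import Mathlib.Data.Fin.SuccPred
import Mathlib.Data.Fintype.Pi
import Mathlib.Data.Fintype.BigOperators
import Mathlib.Algebra.BigOperators.Group.Finset.Basic
import Mathlib.Algebra.Order.BigOperators.Group.Finset
import Mathlib.Tactic.Ring
import HarnessLib

/-!
# Counting adjacency-constrained label sequences by their number of distinct labels
(the counting step of the trace method; Allen–O'Donnell–Witmer 2015, App. A.4)

Trunk T-CPLX-CORE (Literature/Computability/Complexity). Support file for the discharge of the
named fact `allen_odonnell_witmer_kSAT` (`AOWRefutation.lean`), probabilistic part III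
(pure combinatorics).

In the trace method one bounds `E tr((BᵀB)^q)` by a sum over closed walks of label sequences
`W : [N] → Λ` (`N = 2q`), each weighted by `p^{#distinct labels}`; what is needed is a bound on the
number of such sequences with exactly `d` distinct labels. Here the walk structure is abstracted
to an **adjacency constraint** `adj t a b` between the labels at consecutive positions `t, t+1`
(`IsAdjSeq`), with the hypothesis that a label has at most `D` neighbours
(`∀ t a, #{b | adj t a b} ≤ D`). Scanning the sequence from left to right, each position carries
either an OLD label (at most `N` choices) or a NEW one (at most `D` choices, being adjacent to
its predecessor), whence (`card_adjSeqs_le`)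

  `#{W : [N] → Λ adjacency-constrained with exactly d distinct labels} ≤ |Λ| · N^{N-1} · D^{d-1}`.

This is the counting behind "the number of choices of `J` with `|J| = a` is at most
`n^{a(k-1)/2} a^{4r}`" in AOW, App. A.4, in the generality needed for all the level matrices of
the `k`-SAT refuter. Also: a sequence in which every label occurs at least twice has at most
`N/2` distinct labels (`two_mul_numLabels_le`).

## References

* S. R. Allen, R. O'Donnell, D. Witmer, *How to refute a random CSP*, FOCS 2015,
  arXiv:1505.04383, App. A.4 (proof of Lemma A.2: counting `J`, `L` by `|J|`, `|L|`).
* Z. Füredi, J. Komlós, *The eigenvalues of random symmetric matrices*, Combinatorica 1 (1981),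
  §3 (counting closed walks by the number of distinct vertices).
-/

namespace Literature.Computability.Complexity

open Finset

variable {Λ : Type} [Fintype Λ] [DecidableEq Λ]

/-! ### Adjacency-constrained sequences -/

/-- `W : [N] → Λ` is adjacency-constrained: consecutive labels satisfy `adj t (W t) (W (t+1))`.
[Allen–O'Donnell–Witmer 2015, App. A.4 (index pattern of `P_{J,L}`)] [folklore] -/
def IsAdjSeq (adj : ℕ → Λ → Λ → Prop) {N : ℕ} (W : Fin N → Λ) : Prop :=
  ∀ t s : Fin N, s.val = t.val + 1 → adj t.val (W t) (W s)

/-- `IsAdjSeq` is decidable. [folklore] -/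
instance instDecidableIsAdjSeq (adj : ℕ → Λ → Λ → Prop) [∀ t a b, Decidable (adj t a b)] {N : ℕ}
    (W : Fin N → Λ) : Decidable (IsAdjSeq adj W) := by
  unfold IsAdjSeq
  infer_instance

/-- The number of distinct labels of a sequence. [folklore] -/
def numLabels {N : ℕ} (W : Fin N → Λ) : ℕ := (univ.image W).card

/-- The adjacency-constrained sequences of length `N` with exactly `d` distinct labels. [folklore] -/
def adjSeqs (adj : ℕ → Λ → Λ → Prop) [∀ t a b, Decidable (adj t a b)] (N d : ℕ) :
    Finset (Fin N → Λ) :=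
  univ.filter fun W => IsAdjSeq adj W ∧ numLabels W = d

/-- Membership in `adjSeqs`. [folklore] -/
theorem mem_adjSeqs {adj : ℕ → Λ → Λ → Prop} [∀ t a b, Decidable (adj t a b)] {N d : ℕ}
    {W : Fin N → Λ} : W ∈ adjSeqs adj N d ↔ IsAdjSeq adj W ∧ numLabels W = d := by
  simp [adjSeqs]

/-! ### Extending a sequence by one label -/

omit [Fintype Λ] [DecidableEq Λ] in
/-- Adjacency of a one-label extension: the old sequence is adjacency-constrained and the new
label is adjacent to the last old one. [folklore] -/
theorem isAdjSeq_snoc_iff (adj : ℕ → Λ → Λ → Prop) {i : ℕ} (P : Fin (i + 1) → Λ) (b : Λ) :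
    IsAdjSeq adj (Fin.snoc P b : Fin (i + 2) → Λ) ↔ IsAdjSeq adj P ∧ adj i (P (Fin.last i)) b := by
  constructor
  · intro h
    refine ⟨fun t s hs => ?_, ?_⟩
    · have := h t.castSucc s.castSucc (by simpa using hs)
      rwa [Fin.snoc_castSucc, Fin.snoc_castSucc] at this
    · have := h (Fin.last i).castSucc (Fin.last (i + 1)) (by simp)
      rwa [Fin.snoc_castSucc, Fin.snoc_last] at this
  · rintro ⟨hP, hb⟩ t s hs
    -- `t` is not the last position
    have ht : t ≠ Fin.last (i + 1) := by
      intro ht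
      have := s.isLt
      rw [ht, Fin.val_last] at hs
      omega
    obtain ⟨t', rfl⟩ := Fin.exists_castSucc_eq.2 ht
    rcases Fin.eq_castSucc_or_eq_last s with ⟨s', rfl⟩ | rfl
    · rw [Fin.snoc_castSucc, Fin.snoc_castSucc]
      exact hP t' s' (by simpa using hs)
    · rw [Fin.snoc_castSucc, Fin.snoc_last]
      have ht' : t' = Fin.last i := by
        apply Fin.ext
        rw [Fin.val_last]
        simp only [Fin.val_castSucc, Fin.val_last] at hs
        omega
      rw [ht']
      simpa using hb

omit [Fintype Λ] in
/-- The labels of a one-label extension. [folklore] -/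
theorem image_univ_snoc {i : ℕ} (P : Fin (i + 1) → Λ) (b : Λ) :
    univ.image (Fin.snoc P b : Fin (i + 2) → Λ) = insert b (univ.image P) := by
  ext x
  simp only [Finset.mem_image, Finset.mem_univ, true_and, Finset.mem_insert]
  constructor
  · rintro ⟨t, rfl⟩
    rcases Fin.eq_castSucc_or_eq_last t with ⟨t', rfl⟩ | rfl
    · exact Or.inr ⟨t', by rw [Fin.snoc_castSucc]⟩
    · exact Or.inl (by rw [Fin.snoc_last])
  · rintro (rfl | ⟨t', rfl⟩)
    · exact ⟨Fin.last (i + 1), by rw [Fin.snoc_last]⟩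
    · exact ⟨t'.castSucc, by rw [Fin.snoc_castSucc]⟩

omit [Fintype Λ] in
/-- The number of distinct labels of a one-label extension: it grows by one iff the new label is
new. [folklore] -/
theorem numLabels_snoc {i : ℕ} (P : Fin (i + 1) → Λ) (b : Λ) :
    numLabels (Fin.snoc P b : Fin (i + 2) → Λ) =
      numLabels P + if b ∈ univ.image P then 0 else 1 := by
  rw [numLabels, image_univ_snoc, numLabels]
  split_ifs with h
  · rw [Finset.insert_eq_of_mem h, add_zero]
  · rw [Finset.card_insert_of_notMem h]

omit [Fintype Λ] in
/-- The number of distinct labels is at most the length. [folklore] -/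
theorem numLabels_le {N : ℕ} (W : Fin N → Λ) : numLabels W ≤ N :=
  Finset.card_image_le.trans (by simp)

omit [Fintype Λ] in
/-- A non-empty sequence has at least one label. [folklore] -/
theorem numLabels_pos {i : ℕ} (W : Fin (i + 1) → Λ) : 0 < numLabels W :=
  Finset.card_pos.2 ⟨W 0, Finset.mem_image_of_mem _ (Finset.mem_univ _)⟩

omit [Fintype Λ] in
/-- A sequence of length one has one label. [folklore] -/
theorem numLabels_one (W : Fin 1 → Λ) : numLabels W = 1 := by
  rw [numLabels, Finset.univ_unique, Finset.image_singleton, Finset.card_singleton]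

/-- There are no non-empty sequences with `0` distinct labels. [folklore] -/
theorem adjSeqs_zero (adj : ℕ → Λ → Λ → Prop) [∀ t a b, Decidable (adj t a b)] (i : ℕ) :
    adjSeqs adj (i + 1) 0 = ∅ := by
  rw [Finset.eq_empty_iff_forall_notMem]
  intro W hW
  have := (mem_adjSeqs.1 hW).2
  exact absurd this (numLabels_pos W).ne'

/-! ### The counting recursion -/

/-- **One step of the count**: a constrained sequence of length `i+2` is a constrained sequence of
length `i+1` followed by an old label (at most `i+1` choices) or a new label adjacent to the last
one (at most `D` choices). [Allen–O'Donnell–Witmer 2015, App. A.4; Füredi–Komlós 1981, §3] [folklore] -/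
theorem card_adjSeqs_succ_le (adj : ℕ → Λ → Λ → Prop) [∀ t a b, Decidable (adj t a b)] {D : ℕ}
    (hD : ∀ t a, (univ.filter (adj t a)).card ≤ D) (i d : ℕ) :
    (adjSeqs adj (i + 2) d).card ≤
      (adjSeqs adj (i + 1) d).card * (i + 1) + (adjSeqs adj (i + 1) (d - 1)).card * D := by
  classical
  -- the targets of the decomposition `W ↦ (init W, W last)`
  let emb : (Fin (i + 1) → Λ) → Λ ↪ (Fin (i + 1) → Λ) × Λ := fun P =>
    ⟨fun b => (P, b), fun b b' h => (Prod.ext_iff.1 h).2⟩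
  let T₁ : Finset ((Fin (i + 1) → Λ) × Λ) :=
    (adjSeqs adj (i + 1) d).biUnion fun P => (univ.image P).map (emb P)
  let T₂ : Finset ((Fin (i + 1) → Λ) × Λ) :=
    (adjSeqs adj (i + 1) (d - 1)).biUnion fun P => (univ.filter (adj i (P (Fin.last i)))).map (emb P)
  have hmaps : Set.MapsTo (fun W : Fin (i + 2) → Λ => (Fin.init W, W (Fin.last (i + 1))))
      (adjSeqs adj (i + 2) d : Set (Fin (i + 2) → Λ)) (T₁ ∪ T₂ : Finset _) := by
    intro W hW
    rw [Finset.mem_coe, mem_adjSeqs] at hW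
    obtain ⟨hadj, hnum⟩ := hW
    set P := Fin.init W with hP
    set b := W (Fin.last (i + 1)) with hb
    have hW : W = Fin.snoc P b := (Fin.snoc_init_self W).symm
    rw [hW, isAdjSeq_snoc_iff] at hadj
    rw [hW, numLabels_snoc] at hnum
    rw [Finset.coe_union, Set.mem_union, Finset.mem_coe, Finset.mem_coe]
    by_cases hmem : b ∈ univ.image P
    · left
      rw [if_pos hmem, add_zero] at hnum
      refine Finset.mem_biUnion.2 ⟨P, mem_adjSeqs.2 ⟨hadj.1, hnum⟩, ?_⟩
      exact Finset.mem_map.2 ⟨b, hmem, rfl⟩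
    · right
      rw [if_neg hmem] at hnum
      refine Finset.mem_biUnion.2 ⟨P, mem_adjSeqs.2 ⟨hadj.1, by omega⟩, ?_⟩
      exact Finset.mem_map.2 ⟨b, Finset.mem_filter.2 ⟨Finset.mem_univ _, hadj.2⟩, rfl⟩
  have hinj : Set.InjOn (fun W : Fin (i + 2) → Λ => (Fin.init W, W (Fin.last (i + 1))))
      (adjSeqs adj (i + 2) d : Set (Fin (i + 2) → Λ)) := by
    intro W _ W' _ h
    simp only [Prod.mk.injEq] at h
    rw [← Fin.snoc_init_self W, ← Fin.snoc_init_self W', h.1, h.2]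
  calc (adjSeqs adj (i + 2) d).card ≤ (T₁ ∪ T₂).card := Finset.card_le_card_of_injOn _ hmaps hinj
    _ ≤ T₁.card + T₂.card := Finset.card_union_le _ _
    _ ≤ (adjSeqs adj (i + 1) d).card * (i + 1) + (adjSeqs adj (i + 1) (d - 1)).card * D := by
        apply add_le_add
        · refine Finset.card_biUnion_le.trans ?_
          rw [← Finset.sum_const_nat fun _ _ => rfl]
          refine Finset.sum_le_sum fun P _ => ?_
          rw [Finset.card_map]
          exact Finset.card_image_le.trans (by simp)
        · refine Finset.card_biUnion_le.trans ?_
          rw [← Finset.sum_const_nat fun _ _ => rfl]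
          refine Finset.sum_le_sum fun P _ => ?_
          rw [Finset.card_map]
          exact hD i _

/-- **The count**: for every length `i+1` and every `d ≥ 1`, the number of adjacency-constrained
sequences with exactly `d` distinct labels is at most `|Λ| · (i+1)^i · D^{d-1}`.
[Allen–O'Donnell–Witmer 2015, App. A.4; Füredi–Komlós 1981, §3] [cite: arXiv150504383, App. A] -/
theorem card_adjSeqs_le (adj : ℕ → Λ → Λ → Prop) [∀ t a b, Decidable (adj t a b)] {D : ℕ}
    (hD : ∀ t a, (univ.filter (adj t a)).card ≤ D) :
    ∀ i d : ℕ, 1 ≤ d → (adjSeqs adj (i + 1) d).card ≤ Fintype.card Λ * (i + 1) ^ i * D ^ (d - 1) := by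
  intro i
  induction i with
  | zero =>
    intro d hd
    rcases Nat.lt_or_ge 1 d with hd1 | hd1
    · -- `d ≥ 2`: no sequence of length one has two labels
      have h0 : (adjSeqs adj 1 d).card = 0 := by
        rw [Finset.card_eq_zero, Finset.eq_empty_iff_forall_notMem]
        intro W hW
        have := (mem_adjSeqs.1 hW).2
        rw [numLabels_one] at this
        omega
      rw [h0]
      exact Nat.zero_le _
    · have hd' : d = 1 := le_antisymm hd1 hd
      subst hd'
      simp only [pow_zero, mul_one, Nat.sub_self]
      calc (adjSeqs adj 1 1).card ≤ (univ : Finset (Fin 1 → Λ)).card := Finset.card_filter_le _ _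
        _ = Fintype.card Λ := by simp
  | succ i ih =>
    intro d hd
    have hstep := card_adjSeqs_succ_le adj hD i d
    have h1 := ih d hd
    have hpow : (i + 1) ^ i ≤ (i + 2) ^ i := Nat.pow_le_pow_left (by omega) i
    rcases Nat.lt_or_ge 1 d with hd2 | hd2
    · -- `d ≥ 2`
      have h2 := ih (d - 1) (by omega)
      have hD1 : D ^ (d - 1 - 1) * D = D ^ (d - 1) := by
        rw [← pow_succ]
        congr 1
        omega
      calc (adjSeqs adj (i + 1 + 1) d).card
          ≤ (adjSeqs adj (i + 1) d).card * (i + 1) + (adjSeqs adj (i + 1) (d - 1)).card * D := hstep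
        _ ≤ Fintype.card Λ * (i + 1) ^ i * D ^ (d - 1) * (i + 1) +
              Fintype.card Λ * (i + 1) ^ i * D ^ (d - 1 - 1) * D :=
            add_le_add (Nat.mul_le_mul_right _ h1) (Nat.mul_le_mul_right _ h2)
        _ = Fintype.card Λ * ((i + 1) ^ i * (i + 2)) * D ^ (d - 1) := by
            rw [mul_assoc (Fintype.card Λ * (i + 1) ^ i) (D ^ (d - 1 - 1)) D, hD1]
            ring
        _ ≤ Fintype.card Λ * (i + 1 + 1) ^ (i + 1) * D ^ (d - 1) := by
            apply Nat.mul_le_mul_right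
            apply Nat.mul_le_mul_left
            rw [pow_succ]
            exact Nat.mul_le_mul_right _ hpow
    · -- `d = 1`
      have hd' : d = 1 := le_antisymm hd2 hd
      subst hd'
      rw [show (1 : ℕ) - 1 = 0 from rfl, adjSeqs_zero, Finset.card_empty, zero_mul, add_zero] at hstep
      calc (adjSeqs adj (i + 1 + 1) 1).card ≤ (adjSeqs adj (i + 1) 1).card * (i + 1) := hstep
        _ ≤ Fintype.card Λ * (i + 1) ^ i * D ^ (1 - 1) * (i + 1) := Nat.mul_le_mul_right _ h1
        _ ≤ Fintype.card Λ * (i + 1 + 1) ^ (i + 1) * D ^ (1 - 1) := by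
            simp only [Nat.sub_self, pow_zero, mul_one]
            rw [mul_assoc, ← pow_succ]
            exact Nat.mul_le_mul_left _ (Nat.pow_le_pow_left (by omega) _)

/-- The count in terms of the length `N ≥ 1`: at most `|Λ| · N^{N-1} · D^{d-1}` sequences.
[Allen–O'Donnell–Witmer 2015, App. A.4] [cite: arXiv150504383, App. A] -/
theorem card_adjSeqs_le' (adj : ℕ → Λ → Λ → Prop) [∀ t a b, Decidable (adj t a b)] {D : ℕ}
    (hD : ∀ t a, (univ.filter (adj t a)).card ≤ D) {N : ℕ} (hN : 0 < N) {d : ℕ} (hd : 1 ≤ d) :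
    (adjSeqs adj N d).card ≤ Fintype.card Λ * N ^ (N - 1) * D ^ (d - 1) := by
  obtain ⟨i, rfl⟩ := Nat.exists_eq_add_one_of_ne_zero hN.ne'
  simpa using card_adjSeqs_le adj hD i d hd

/-! ### Sequences without singletons -/

omit [Fintype Λ] in
/-- If every label of `W` occurs at least twice then `W` has at most `N/2` distinct labels.
[Allen–O'Donnell–Witmer 2015, App. A.4 (Claims 8–9: a factor occurring once kills the
expectation, so `|L| ≤ r`)] [cite: arXiv150504383, App. A] -/
theorem two_mul_numLabels_le {N : ℕ} (W : Fin N → Λ) (h : ∀ t, ∃ s, s ≠ t ∧ W s = W t) :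
    2 * numLabels W ≤ N := by
  calc 2 * numLabels W = ∑ _b ∈ univ.image W, 2 := by
        rw [Finset.sum_const_nat fun _ _ => rfl, numLabels, mul_comm]
    _ ≤ ∑ b ∈ univ.image W, (univ.filter fun a => W a = b).card := by
        refine Finset.sum_le_sum fun b hb => ?_
        obtain ⟨t, -, rfl⟩ := Finset.mem_image.1 hb
        obtain ⟨s, hst, hs⟩ := h t
        rw [Nat.succ_le_iff, Finset.one_lt_card_iff]
        exact ⟨s, t, by simp [hs], by simp, hst⟩
    _ = (univ : Finset (Fin N)).card := (Finset.card_eq_sum_card_image W univ).symm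
    _ = N := by simp

end Literature.Computability.Complexity
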